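import Literature.AnabelianGeometry.Anabelioids.ExactFunctorProofs
import Literature.AnabelianGeometry.Anabelioids.FiberFunctorUnique
import Literature.AnabelianGeometry.SemiGraphs.GraphOfAnabelioids
import Literature.AnabelianGeometry.SemiGraphs.SubdivisionLemmas

/-!
# The degree of a finite étale covering of a connected semi-graph of anabelioids

Mochizuki, *Semi-graphs of anabelioids*, Publ. RIMS **42** (2006), Def. 2.2 (i) p. 23
[cite: MochizukiSemiAnbd2006, Def. 2.2(i) p.23]: an object `{S_v, T_e, ψ_b}` of `B(𝒢)` is a finite étale
covering `𝒢' → 𝒢` "which lies over some proper morphism of semi-graphs"; over a CONNECTED `𝒢` it has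
a well-defined degree: the cardinality of the fibre of `S_v` (resp. `T_e`) at any basepoint of `𝒢_v`
(resp. `𝒢_e`) is independent of the component (`BObj.exists_degree`).  Proof: fibre functors of a
connected anabelioid are isomorphic ([GeoAn] §1.1 p. 10, `nonempty_iso_of_fiberFunctor`), an exact
`b^*` followed by a fibre functor is a fibre functor, and the gluing isomorphisms
`ψ_b : b^* S_v ⥲ T_e` transport cardinalities along the (connected) barycentric subdivision.  Used
for the Galois-countability fact [IUTchI] Rmk. 2.5.3 (i) (T4).  Proof-only (no definitions).
-/

namespace Literature.AnabelianGeometry.SemiGraphs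

open CategoryTheory CategoryTheory.Limits CategoryTheory.PreGaloisCategory
open Literature.AnabelianGeometry.Anabelioids

universe v₁ u₁ u

namespace SemiGraphOfAnabelioids

/-- Fibre cardinalities do not depend on the basepoint. [cite: MochizukiGeoAn2004, §1.1 p.10] -/
theorem card_fiber_eq_of_fiberFunctor {C : Type u₁} [Category.{v₁} C] [GaloisCategory C]
    (F F' : C ⥤ FintypeCat.{v₁}) [FiberFunctor F] [FiberFunctor F'] (Y : C) :
    Nat.card (F.obj Y) = Nat.card (F'.obj Y) := by
  obtain ⟨α⟩ := nonempty_iso_of_fiberFunctor F F'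
  exact Nat.card_congr (FintypeCat.equivEquivIso.symm (α.app Y))

/-- **Degree of an object of `B(𝒢)` over a connected `𝒢`**: there is a `d` such that every fibre of
every `S_v` and every `T_e`, at every basepoint, has exactly `d` points.
[cite: MochizukiSemiAnbd2006, Def. 2.2(i) p.23] -/
theorem BObj.exists_degree (𝒢 : SemiGraphOfAnabelioids.{v₁, u₁, u}) (hG : 𝒢.IsConnected)
    (B : 𝒢.BObj) : ∃ d : ℕ,
      (∀ (v : 𝒢.graph.Vertex) (F : 𝒢.V v ⥤ FintypeCat.{v₁}) [FiberFunctor F],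
        Nat.card (F.obj (B.S v)) = d) ∧
      ∀ (e : 𝒢.graph.Edge) (F : 𝒢.E e ⥤ FintypeCat.{v₁}) [FiberFunctor F],
        Nat.card (F.obj (B.T e)) = d := by
  -- the degree at each node of the barycentric subdivision, at the chosen basepoints
  let q : 𝒢.graph.Node → ℕ := fun x =>
    match x with
    | Sum.inl v => Nat.card ((GaloisCategory.getFiberFunctor (𝒢.V v)).obj (B.S v))
    | Sum.inr (Sum.inl e) => Nat.card ((GaloisCategory.getFiberFunctor (𝒢.E e)).obj (B.T e))
    | Sum.inr (Sum.inr b) =>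
        Nat.card ((GaloisCategory.getFiberFunctor (𝒢.E (𝒢.graph.edgeOf b))).obj
          (B.T (𝒢.graph.edgeOf b)))
  have hstep : ∀ x y : 𝒢.graph.Node, 𝒢.graph.NodeRel x y → q x = q y := by
    intro x y hr
    cases hr with
    | edge_branch b => rfl
    | branch_vertex b v h =>
      -- `|T_e| = |b^* S_v| = |S_v|`
      let Fe := GaloisCategory.getFiberFunctor (𝒢.E (𝒢.graph.edgeOf b))
      change Nat.card (Fe.obj (B.T (𝒢.graph.edgeOf b))) =
        Nat.card ((GaloisCategory.getFiberFunctor (𝒢.V v)).obj (B.S v))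
      rw [← card_fiber_eq_of_iso Fe (B.ψ b v h)]
      haveI : FiberFunctor ((𝒢.pull b v h).pullback ⋙ Fe) := fiberFunctor_comp_of_exact _ Fe
      exact card_fiber_eq_of_fiberFunctor ((𝒢.pull b v h).pullback ⋙ Fe) _ (B.S v)
  have hq : ∀ x y : 𝒢.graph.Node, q x = q y := by
    intro x y
    obtain ⟨w⟩ := hG.isConnected.connected x y
    induction w with
    | nil => rfl
    | cons hadj _ ih =>
      refine Eq.trans ?_ ih
      rcases (SimpleGraph.fromRel_adj _ _ _).1 hadj with ⟨-, hr | hr⟩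
      · exact hstep _ _ hr
      · exact (hstep _ _ hr).symm
  obtain ⟨x₀⟩ := hG.isConnected.connected.nonempty
  refine ⟨q x₀, fun v F _ => ?_, fun e F _ => ?_⟩
  · rw [card_fiber_eq_of_fiberFunctor F (GaloisCategory.getFiberFunctor (𝒢.V v))]
    exact hq (Sum.inl v) x₀
  · rw [card_fiber_eq_of_fiberFunctor F (GaloisCategory.getFiberFunctor (𝒢.E e))]
    exact hq (Sum.inr (Sum.inl e)) x₀

end SemiGraphOfAnabelioids

end Literature.AnabelianGeometry.SemiGraphs
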